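import Summits.RiemannHypothesis.RiemannHypothesis.Theorems.OddSectorOddOneSignedWindowsFoldCriterion
import Summits.RiemannHypothesis.RiemannHypothesis.Theorems.OddSectorOddOneSignedWindowsFoldPrimeIncrement
import Summits.RiemannHypothesis.RiemannHypothesis.Theorems.OddSectorOddOneSignedWindowsFoldArchGain
import Summits.RiemannHypothesis.RiemannHypothesis.Theorems.OddSectorOddOneSignedWindowsArchGainLiminf
import Summits.RiemannHypothesis.RiemannHypothesis.Theorems.OddSectorOddOneSignedWindowsLayerDefs
import HarnessLib

/-!
# The origin-layer lemma, variational form (RH-free; line `Sketch` of crux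
# `OddSector.OddOneSignedWindows`, item stmt-RiemannHypothesis-17778)

`stub_originLayerLemma` (registered stub of the line skeleton `Cruxes/OddOneSignedWindows/Lines/Sketch.lean`):
let `u` be a REAL odd-sector ground state of Weil's windowed form at the window `a`
(`IsWeilOddGroundState a u`), let `0 < η ≤ log 2`, `η < a`, and assume

* (bulk sign) `Re u ≥ 0` a.e. on `[η, a)`;
* (layer domination) for a.e. `x ∈ (0, η)` with `Re u(x) < 0`,
  `layerPrimeDefect a u x ≤ layerArchGlue a η u x`
  (`Σ_{log n<2a} Λ(n)n^{-1/2}(u⁺(log n − x) − u⁺(log n + x)) ≤ ∫_{(η,a)} Re u(y)(ρ(|x−y|) − ρ(x+y)) dy`).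

Then the antisymmetric fold `x ↦ sign(x)|u(x)|` is again an odd-sector ground state at `a` (hence
a real one, `≥ 0` on `(0, ∞)`).

## Proof (form domain; no Euler–Lagrange equation, no coercivity constant)

By `IsWeilOddGroundState.finiteEnergy`, `P(u) + 𝓔_a(u) ≤ M_a + ε_od(a)`, and by
`isWeilOddGroundState_of_energy_le` every odd `L²` window function `v` with `‖v‖₂ = 1`, finite
archimedean energy and `P(v) + 𝓔_a(v) ≤ M_a + ε_od(a)` is an odd-sector ground state. For the fold
`v = sign·|w|` of a good representative `w` of `u` (`exists_oddRepr`):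

* the pole form folds, `P(v) ≤ P(w)` (`weilPoleForm_signFold_le`);
* the archimedean energy folds WITH A GAIN: `∫ρD(v) + gain ≤ ∫ρD(w)` (`stub_foldArchGain`, the
  quantitative folded-kernel inequality, with `g = w`, `h = v`), and the gain is
  `≥ 8 ∫_{(0,η)} w⁻ · layerArchGlue` (`stub_archGainLiminf` with the constant sequence `w`);
* each prime increment changes by at most `8 ∫_{(0,η)} w⁻ (w⁺(log n − ·) − w⁺(log n + ·))`
  (`stub_foldPrimeIncrement` at `ℓ = log n ≥ log 2 ≥ η`), so the prime energy changes by at most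
  `8 ∫_{(0,η)} w⁻ · layerPrimeDefect`;
* domination makes `8 ∫ w⁻ · (layerPrimeDefect − layerArchGlue) ≤ 0`.

Hence `P(v) + 𝓔_a(v) ≤ P(w) + 𝓔_a(w) ≤ M_a + ε_od(a)`.
-/

noncomputable section

set_option linter.dupNamespace false

open MeasureTheory Set Filter
open scoped Topology ENNReal ComplexConjugate ArithmeticFunction.vonMangoldt

namespace Summit.RiemannHypothesis.RiemannHypothesis.Theorems.OddSector

open Literature.NumberTheory.LFunctions
open Summit.RiemannHypothesis.RiemannHypothesis.Theorems.OddArchAnchor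

/-! ### Invariance of the layer functionals under a.e. modification -/

/-- The archimedean glue only sees the a.e. class of the state. [folklore] -/
theorem layerArchGlue_congr_ae {a η : ℝ} {u w : ℝ → ℂ} (h : w =ᵐ[volume] u) (x : ℝ) :
    layerArchGlue a η w x = layerArchGlue a η u x := by
  unfold layerArchGlue
  refine integral_congr_ae ((ae_restrict_of_ae h).mono fun y hy ↦ ?_)
  simp only [hy]

/-- The prime defect of a.e.-equal states agrees a.e. (finitely many translates and reflections
of a null set are null). [folklore] -/
theorem layerPrimeDefect_ae_congr {a : ℝ} {u w : ℝ → ℂ} (h : w =ᵐ[volume] u) :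
    ∀ᵐ x : ℝ, layerPrimeDefect a w x = layerPrimeDefect a u x := by
  have h1 : ∀ n ∈ weilPrimeIndex a, ∀ᵐ x : ℝ,
      w (Real.log n - x) = u (Real.log n - x) ∧ w (Real.log n + x) = u (Real.log n + x) := by
    intro n _
    have e1 : ∀ᵐ x : ℝ, w (Real.log n - x) = u (Real.log n - x) :=
      (Measure.measurePreserving_sub_left (volume : Measure ℝ) (Real.log n)).quasiMeasurePreserving
        |>.tendsto_ae.eventually h
    have e2 : ∀ᵐ x : ℝ, w (Real.log n + x) = u (Real.log n + x) :=
      (measurePreserving_add_left (volume : Measure ℝ) (Real.log n)).quasiMeasurePreserving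
        |>.tendsto_ae.eventually h
    filter_upwards [e1, e2] with x hx1 hx2
    exact ⟨hx1, hx2⟩
  have h2 := (Filter.eventually_all_finset (weilPrimeIndex a)).2 h1
  filter_upwards [h2] with x hx
  unfold layerPrimeDefect
  refine Finset.sum_congr rfl fun n hn ↦ ?_
  rw [(hx n hn).1, (hx n hn).2]

/-! ### Sign and measurability of the archimedean glue -/

/-- The folded archimedean kernel is non-negative off the diagonal: `ρ(x+y) ≤ ρ(|x − y|)` for
`0 < x < y`. [folklore] -/
theorem weilArchDensity_add_le_abs_sub {x y : ℝ} (hx : 0 < x) (hxy : x < y) :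
    weilArchDensity (x + y) ≤ weilArchDensity |x - y| := by
  rw [abs_sub_comm, abs_of_pos (sub_pos.2 hxy)]
  exact weilArchDensity_antitoneOn (mem_Ioi.2 (sub_pos.2 hxy)) (mem_Ioi.2 (by linarith))
    (by linarith)

/-- The archimedean glue of a state which is `≥ 0` a.e. on the bulk `[η, a)` is non-negative at
every layer point `x ∈ (0, η)`. [folklore] -/
theorem layerArchGlue_nonneg {a η : ℝ} {u : ℝ → ℂ} {x : ℝ} (hx : x ∈ Ioo 0 η)
    (hbulk : ∀ᵐ t : ℝ, t ∈ Ico η a → 0 ≤ (u t).re) : 0 ≤ layerArchGlue a η u x := by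
  unfold layerArchGlue
  refine setIntegral_nonneg_of_ae_restrict ?_
  rw [Filter.EventuallyLE, ae_restrict_iff' measurableSet_Ioo]
  filter_upwards [hbulk] with y hy hyI
  have hxy : x < y := hx.2.trans hyI.1
  show (0 : ℝ) ≤ _
  exact mul_nonneg (hy ⟨hyI.1.le, hyI.2⟩)
    (sub_nonneg.2 (weilArchDensity_add_le_abs_sub hx.1 hxy))

/-- The archimedean glue of a measurable state is a measurable function of the layer point.
[folklore] -/
theorem measurable_layerArchGlue {a η : ℝ} {w : ℝ → ℂ} (hwm : Measurable w) :
    Measurable fun x ↦ layerArchGlue a η w x := by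
  have hF : Measurable (Function.uncurry fun x y : ℝ ↦
      (w y).re * (weilArchDensity |x - y| - weilArchDensity (x + y))) :=
    (Complex.measurable_re.comp (hwm.comp measurable_snd)).mul
      ((measurable_weilArchDensity.comp ((measurable_fst.sub measurable_snd).abs)).sub
        (measurable_weilArchDensity.comp (measurable_fst.add measurable_snd)))
  have hS : StronglyMeasurable (Function.uncurry fun x y : ℝ ↦
      (w y).re * (weilArchDensity |x - y| - weilArchDensity (x + y))) := hF.stronglyMeasurable
  exact (hS.integral_prod_right (ν := volume.restrict (Ioo η a))).measurable

/-! ### The origin-layer lemma -/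

/-- **ORIGIN-LAYER LEMMA, variational form** (RH-free; registered stub `stub_originLayerLemma` of
the line skeleton of crux stmt-RiemannHypothesis-17778). For a real odd-sector ground state `u`
at the window `a`, a layer width `0 < η ≤ log 2` with `η < a`, the bulk sign hypothesis
`Re u ≥ 0` a.e. on `[η, a)` and the layer domination `layerPrimeDefect ≤ layerArchGlue` a.e. on
the part of `(0, η)` where `Re u < 0`, the antisymmetric fold `x ↦ sign(x)|u(x)|` is again an
odd-sector ground state at the window `a`. See the module docstring for the proof. -/
theorem stub_originLayerLemma :
    ∀ (a η : ℝ) (u : ℝ → ℂ), 0 < η → η ≤ Real.log 2 → η < a →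
      IsWeilOddGroundState a u → (∀ t, (u t).im = 0) →
      (∀ᵐ t : ℝ, t ∈ Ico η a → 0 ≤ (u t).re) →
      (∀ᵐ x : ℝ, x ∈ Ioo 0 η → (u x).re < 0 → layerPrimeDefect a u x ≤ layerArchGlue a η u x) →
      IsWeilOddGroundState a (fun x ↦ ((Real.sign x * ‖u x‖ : ℝ) : ℂ)) := by
  intro a η u hη hηlog hηa hu hreal hbulk hdom
  have ha : 0 < a := hu.pos
  /- (0) a good representative `w` of `u` and the transfer of the hypotheses -/
  obtain ⟨w, hwm, hwo, hws, hwreal, hwu⟩ := exists_oddRepr hu hreal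
  have hw : IsWeilOddGroundState a w := hu.congr_ae hwu.symm
  have hw2 : MemLp w 2 := hw.memLp
  have hws_ae : ∀ᵐ t : ℝ, t ∉ Icc (-a) a → w t = 0 := Eventually.of_forall hws
  have hwo_ae : ∀ᵐ t : ℝ, w (-t) = -w t := Eventually.of_forall hwo
  have hbulk_w : ∀ᵐ t : ℝ, t ∈ Ico η a → 0 ≤ (w t).re := by
    filter_upwards [hbulk, hwu] with t h1 h2 ht
    rw [h2]
    exact h1 ht
  have hpos_w : ∀ᵐ t : ℝ, η ≤ t → 0 ≤ (w t).re := by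
    have hne : ∀ᵐ t : ℝ, t ∉ ({a} : Set ℝ) := measure_eq_zero_iff_ae_notMem.1 (measure_singleton a)
    filter_upwards [hbulk_w, hne] with t h1 h2 ht
    rcases lt_or_gt_of_ne (show t ≠ a from h2) with hlt | hgt
    · exact h1 ⟨ht, hlt⟩
    · rw [hws t (fun h ↦ not_lt.2 h.2 hgt), Complex.zero_re]
  have hdom_w : ∀ᵐ x : ℝ, x ∈ Ioo 0 η → (w x).re < 0 →
      layerPrimeDefect a w x ≤ layerArchGlue a η w x := by
    filter_upwards [hdom, hwu, layerPrimeDefect_ae_congr (a := a) hwu] with x hd hx hdef hx0 hneg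
    rw [hdef, layerArchGlue_congr_ae hwu]
    rw [hx] at hneg
    exact hd hx0 hneg
  /- (1) the fold `v` of `w` -/
  set v : ℝ → ℂ := fun x ↦ (((Real.sign x * ‖w x‖ : ℝ)) : ℂ) with hv
  have hvm : Measurable v := measurable_signFold hwm
  have hv2 : MemLp v 2 := memLp_signFold hw2
  have hvo : ∀ x, v (-x) = -v x := signFold_neg hwo
  have hvs : ∀ x, x ∉ Icc (-a) a → v x = 0 := fun x hx ↦ by
    simp only [hv, hws x hx, norm_zero, mul_zero, Complex.ofReal_zero]
  have hvn : ∫ x, ‖v x‖ ^ 2 = 1 := by rw [hv, integral_norm_sq_signFold w, hw.integral_norm_sq]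
  have hrad : ∀ x s, 0 < x → 0 < s → ‖v s - v x‖ ≤ |‖w s‖ - ‖w x‖| := fun x s hx hs ↦ by
    simp only [hv, Real.sign_of_pos hx, Real.sign_of_pos hs, one_mul, ← Complex.ofReal_sub,
      Complex.norm_real, Real.norm_eq_abs, le_refl]
  have hle : ∀ x, 0 < x → ‖v x‖ ≤ ‖w x‖ := fun x hx ↦ by
    simp only [hv, Real.sign_of_pos hx, one_mul, Complex.norm_real, norm_norm, le_refl]
  /- (2) energies of `w`; the pole form and the archimedean energy of `v` -/
  obtain ⟨hEw, hle_w⟩ := hw.finiteEnergy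
  obtain ⟨hEv, -⟩ := archEnergy_signFold_le hwm hw2 hwo hws hEw
  have hpole := weilPoleForm_signFold_le (w := w) hwo
  /- (3) the archimedean energy folds with a gain -/
  set G : ℝ≥0∞ := ∫⁻ x in Ioi (0 : ℝ), ∫⁻ s in Ioi (0 : ℝ),
    ENNReal.ofReal ((‖w s‖ * ‖w x‖ - (w s * conj (w x)).re) *
      (weilArchDensity |s - x| - weilArchDensity (x + s))) with hG
  set A : (ℝ → ℂ) → ℝ := fun f ↦ ∫ t in Ioi (0 : ℝ), weilArchDensity t * weilIncrement f t with hA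
  have hgainL := stub_foldArchGain w v hwm hvm hwo hvo hrad hle
  -- conversions between `lintegral` and Bochner integrals
  have hinner : ∀ (f : ℝ → ℂ), MemLp f 2 → ∀ t, ∫⁻ x, ENNReal.ofReal (‖f (x + t) - f x‖ ^ 2) =
      ENNReal.ofReal (weilIncrement f t) := fun f hf t ↦ by
    rw [weilIncrement, ofReal_integral_eq_lintegral_ofReal (integrable_weilIncrement_integrand hf t)
      (Eventually.of_forall fun x ↦ by positivity)]
  have hnn : ∀ f : ℝ → ℂ, 0 ≤ᵐ[volume.restrict (Ioi 0)] fun t ↦ weilArchDensity t * weilIncrement f t :=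
    fun f ↦ (ae_restrict_iff' measurableSet_Ioi).2 (Eventually.of_forall fun t ht ↦
      mul_nonneg (weilArchDensity_pos ht).le (weilIncrement_nonneg f t))
  have hL : ∀ (f : ℝ → ℂ), MemLp f 2 →
      IntegrableOn (fun t ↦ weilArchDensity t * weilIncrement f t) (Ioi 0) →
      (∫⁻ t in Ioi (0 : ℝ), ENNReal.ofReal (weilArchDensity t) *
        ∫⁻ x, ENNReal.ofReal (‖f (x + t) - f x‖ ^ 2)) = ENNReal.ofReal (A f) := fun f hf hfE ↦ by
    rw [hA, ofReal_integral_eq_lintegral_ofReal hfE (hnn f)]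
    refine setLIntegral_congr_fun measurableSet_Ioi fun t ht ↦ ?_
    rw [hinner f hf t, ← ENNReal.ofReal_mul (weilArchDensity_pos ht).le]
  rw [hL v hv2 hEv, hL w hw2 hEw] at hgainL
  -- `hgainL : ofReal (A v) + 2 * G ≤ ofReal (A w)`
  have h2G : 2 * G ≠ ⊤ :=
    ne_top_of_le_ne_top ENNReal.ofReal_ne_top (le_trans le_add_self hgainL)
  have hAw0 : 0 ≤ A w := setIntegral_nonneg measurableSet_Ioi fun t ht ↦
    mul_nonneg (weilArchDensity_pos ht).le (weilIncrement_nonneg w t)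
  have hAv0 : 0 ≤ A v := setIntegral_nonneg measurableSet_Ioi fun t ht ↦
    mul_nonneg (weilArchDensity_pos ht).le (weilIncrement_nonneg v t)
  have harch : A v + (2 * G).toReal ≤ A w := by
    have h1 : ENNReal.ofReal (A v + (2 * G).toReal) ≤ ENNReal.ofReal (A w) := by
      rw [ENNReal.ofReal_add hAv0 ENNReal.toReal_nonneg, ENNReal.ofReal_toReal h2G]
      exact hgainL
    exact (ENNReal.ofReal_le_ofReal_iff hAw0).1 h1
  /- (4) the gain dominates `8 ∫ W · glue`, `W` the layer negative part of `w` -/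
  set W : ℝ → ℝ := fun x ↦ (layerNegPart η w x).re with hW_def
  have hlim := stub_archGainLiminf a η w (fun _ ↦ w) hη hηa hw2 hwreal hws_ae hbulk_w
    (fun _ ↦ hwm) (Eventually.of_forall fun x ↦ tendsto_const_nhds)
  rw [Filter.liminf_const] at hlim
  -- `hlim : ∫⁻ x in Ioo 0 η, ofReal (8 * (W x * glue x)) ≤ 2 * G`
  have hW0 : ∀ x, 0 ≤ W x := fun x ↦ layerNegPart_re_nonneg η w x
  have hglue0 : ∀ x ∈ Ioo 0 η, 0 ≤ layerArchGlue a η w x := fun x hx ↦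
    layerArchGlue_nonneg hx hbulk_w
  have hWmeas : Measurable W := by
    have : W = (Ioo 0 η).indicator fun y ↦ max (-(w y).re) 0 := by
      funext x; simp [hW_def, layerNegPart]
    rw [this]
    exact ((Complex.measurable_re.comp hwm).neg.max measurable_const).indicator measurableSet_Ioo
  have hWg_meas : Measurable fun x ↦ W x * layerArchGlue a η w x :=
    hWmeas.mul (measurable_layerArchGlue hwm)
  have hWg_nn : 0 ≤ᵐ[volume.restrict (Ioo 0 η)] fun x ↦ W x * layerArchGlue a η w x :=
    (ae_restrict_iff' measurableSet_Ioo).2 (Eventually.of_forall fun x hx ↦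
      mul_nonneg (hW0 x) (hglue0 x hx))
  have hWg_int : IntegrableOn (fun x ↦ W x * layerArchGlue a η w x) (Ioo 0 η) := by
    refine ⟨hWg_meas.aestronglyMeasurable, (hasFiniteIntegral_iff_ofReal hWg_nn).2 ?_⟩
    calc ∫⁻ x in Ioo 0 η, ENNReal.ofReal (W x * layerArchGlue a η w x)
        ≤ ∫⁻ x in Ioo 0 η, ENNReal.ofReal (8 * ((layerNegPart η w x).re * layerArchGlue a η w x)) := by
          refine setLIntegral_mono' measurableSet_Ioo fun x hx ↦ ENNReal.ofReal_le_ofReal ?_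
          have := mul_nonneg (hW0 x) (hglue0 x hx)
          simp only [hW_def] at this ⊢
          linarith
      _ ≤ 2 * G := hlim
      _ < ⊤ := lt_top_iff_ne_top.2 h2G
  have hgain_ge : 8 * ∫ x in Ioo 0 η, W x * layerArchGlue a η w x ≤ (2 * G).toReal := by
    have h8nn : 0 ≤ᵐ[volume.restrict (Ioo 0 η)]
        fun x ↦ 8 * ((layerNegPart η w x).re * layerArchGlue a η w x) :=
      (ae_restrict_iff' measurableSet_Ioo).2 (Eventually.of_forall fun x hx ↦
        mul_nonneg (by norm_num) (mul_nonneg (hW0 x) (hglue0 x hx)))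
    have h8m : AEStronglyMeasurable (fun x ↦ 8 * ((layerNegPart η w x).re * layerArchGlue a η w x))
        (volume.restrict (Ioo 0 η)) := (hWg_meas.const_mul 8).aestronglyMeasurable
    rw [← integral_const_mul]
    change ∫ x in Ioo 0 η, 8 * ((layerNegPart η w x).re * layerArchGlue a η w x) ≤ (2 * G).toReal
    rw [integral_eq_lintegral_of_nonneg_ae h8nn h8m]
    exact ENNReal.toReal_mono h2G hlim
  /- (5) the prime increments -/
  have hf_meas : AEStronglyMeasurable (fun y ↦ (w y).re) volume :=
    Complex.continuous_re.comp_aestronglyMeasurable hw2.1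
  have hf : MemLp (fun y ↦ (w y).re) 2 volume :=
    hw2.of_le hf_meas (Eventually.of_forall fun x ↦ by
      rw [Real.norm_eq_abs]; exact Complex.abs_re_le_norm _)
  have hFp : MemLp (fun y ↦ max ((w y).re) 0) 2 volume := by
    refine hf.of_le (hf_meas.sup aestronglyMeasurable_const) (Eventually.of_forall fun x ↦ ?_)
    rw [Real.norm_eq_abs, Real.norm_eq_abs, abs_of_nonneg (le_max_right _ _)]
    exact max_le (le_abs_self _) (abs_nonneg _)
  have hWmem : MemLp W 2 volume := by
    refine hf.of_le hWmeas.aestronglyMeasurable (Eventually.of_forall fun x ↦ ?_)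
    rw [Real.norm_eq_abs, Real.norm_eq_abs, abs_of_nonneg (hW0 x)]
    by_cases hx : x ∈ Ioo 0 η
    · simp only [hW_def, layerNegPart_eq_of_mem hx, Complex.ofReal_re]
      exact max_le (neg_le_abs _) (abs_nonneg _)
    · simp only [hW_def, layerNegPart_eq_zero_of_notMem hx, Complex.zero_re]
      exact abs_nonneg _
  -- the per-length defect densities are integrable
  have hdens_int : ∀ ℓ : ℝ, Integrable
      (fun x ↦ W x * (max ((w (ℓ - x)).re) 0 - max ((w (ℓ + x)).re) 0)) volume := by
    intro ℓ
    have h1 : Integrable (fun x ↦ W x * max ((w (ℓ - x)).re) 0) volume :=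
      hWmem.integrable_mul (hFp.comp_measurePreserving (Measure.measurePreserving_sub_left volume ℓ))
    have h2 : Integrable (fun x ↦ W x * max ((w (ℓ + x)).re) 0) volume :=
      hWmem.integrable_mul (hFp.comp_measurePreserving (measurePreserving_add_left volume ℓ))
    refine (h1.sub h2).congr (Eventually.of_forall fun x ↦ ?_)
    simp only [Pi.sub_apply]
    ring
  set r : ℕ → ℝ := fun n ↦ (Λ n : ℝ) / Real.sqrt n with hr
  have hr0 : ∀ n, 0 ≤ r n := fun n ↦
    div_nonneg ArithmeticFunction.vonMangoldt_nonneg (Real.sqrt_nonneg _)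
  set I : ℕ → ℝ := fun n ↦ ∫ x in Ioo 0 η,
    W x * (max ((w (Real.log n - x)).re) 0 - max ((w (Real.log n + x)).re) 0) with hI
  have hprime : ∀ n ∈ weilPrimeIndex a,
      r n * weilIncrement v (Real.log n) ≤ r n * weilIncrement w (Real.log n) + r n * (8 * I n) := by
    intro n _
    rcases Nat.lt_or_ge n 2 with hn2 | hn2
    · have hΛ : r n = 0 := by
        interval_cases n <;> simp [hr]
      simp [hΛ]
    · have hlog : η ≤ Real.log n := by
        refine hηlog.trans (Real.log_le_log two_pos ?_)
        exact_mod_cast hn2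
      have hst := stub_foldPrimeIncrement η (Real.log n) w hη hlog hw2 hwreal hwo_ae hpos_w
      have h1 : weilIncrement v (Real.log n) ≤ weilIncrement w (Real.log n) + 8 * I n := by
        simp only [hI, hW_def]
        linarith
      have := mul_le_mul_of_nonneg_left h1 (hr0 n)
      linarith [this]
  have hsumI : ∑ n ∈ weilPrimeIndex a, r n * (8 * I n) =
      8 * ∫ x in Ioo 0 η, W x * layerPrimeDefect a w x := by
    have e1 : ∀ n ∈ weilPrimeIndex a, r n * (8 * I n) =
        8 * ∫ x in Ioo 0 η, r n * (W x * (max ((w (Real.log n - x)).re) 0 -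
          max ((w (Real.log n + x)).re) 0)) := by
      intro n _
      rw [integral_const_mul]
      simp only [hI]
      ring
    rw [Finset.sum_congr rfl e1, ← Finset.mul_sum, ← integral_finsetSum (weilPrimeIndex a) (fun n _ ↦
      ((hdens_int (Real.log n)).const_mul (r n)).integrableOn)]
    congr 1
    refine integral_congr_ae (Eventually.of_forall fun x ↦ ?_)
    simp only [layerPrimeDefect, hr, Finset.mul_sum]
    refine Finset.sum_congr rfl fun n _ ↦ ?_
    ring
  have hprimeSum : ∑ n ∈ weilPrimeIndex a, r n * weilIncrement v (Real.log n) ≤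
      (∑ n ∈ weilPrimeIndex a, r n * weilIncrement w (Real.log n)) +
        8 * ∫ x in Ioo 0 η, W x * layerPrimeDefect a w x := by
    rw [← hsumI, ← Finset.sum_add_distrib]
    exact Finset.sum_le_sum hprime
  /- (6) domination: `∫ W · defect ≤ ∫ W · glue` -/
  have hWd_int : IntegrableOn (fun x ↦ W x * layerPrimeDefect a w x) (Ioo 0 η) := by
    have : (fun x ↦ W x * layerPrimeDefect a w x) =
        fun x ↦ ∑ n ∈ weilPrimeIndex a, r n * (W x * (max ((w (Real.log n - x)).re) 0 -
          max ((w (Real.log n + x)).re) 0)) := by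
      funext x
      simp only [layerPrimeDefect, hr, Finset.mul_sum]
      refine Finset.sum_congr rfl fun n _ ↦ ?_
      ring
    rw [this]
    exact (integrable_finsetSum (weilPrimeIndex a) fun n _ ↦
      (hdens_int (Real.log n)).const_mul (r n)).integrableOn
  have hdomI : ∫ x in Ioo 0 η, W x * layerPrimeDefect a w x ≤
      ∫ x in Ioo 0 η, W x * layerArchGlue a η w x := by
    refine integral_mono_ae hWd_int hWg_int ?_
    rw [Filter.EventuallyLE, ae_restrict_iff' measurableSet_Ioo]
    filter_upwards [hdom_w] with x hx hxI
    rcases lt_or_ge (w x).re 0 with hneg | hnn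
    · exact mul_le_mul_of_nonneg_left (hx hxI hneg) (hW0 x)
    · have hWx : W x = 0 := by
        simp only [hW_def, layerNegPart_eq_of_mem hxI, Complex.ofReal_re]
        exact max_eq_right (by linarith)
      simp [hWx]
  /- (7) assemble the energy inequality and conclude in the form domain -/
  have hEv_split : weilDirichletEnergy a v =
      (∑ n ∈ weilPrimeIndex a, r n * weilIncrement v (Real.log n)) + A v := rfl
  have hEw_split : weilDirichletEnergy a w =
      (∑ n ∈ weilPrimeIndex a, r n * weilIncrement w (Real.log n)) + A w := rfl
  have hle_v : weilPoleForm v + weilDirichletEnergy a v ≤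
      weilMarkovConstant a + weilOddGroundEnergy a := by
    rw [hEv_split]
    rw [hEw_split] at hle_w
    linarith [hprimeSum, harch, hgain_ge, hdomI, hpole]
  have hvGS : IsWeilOddGroundState a v :=
    isWeilOddGroundState_of_energy_le a v ha hv2 hvs hvo hvn hEv hle_v
  /- (8) back to the fold of `u` itself (a.e. equal to `v`) -/
  refine hvGS.congr_ae ?_
  filter_upwards [hwu] with x hx
  simp only [hv, hx]

end Summit.RiemannHypothesis.RiemannHypothesis.Theorems.OddSector

end
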